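import Summits.Ventures.CertifiedManyBodySolver.Observables.PhaseSeparationExclusionEDopedFarColumns
import Summits.Ventures.CertifiedManyBodySolver.Observables.PhaseSeparationExclusionTPrimeStripTwoFifths
import Summits.Ventures.CertifiedManyBodySolver.Observables.PhaseSeparationExclusionParticleHoleColumns
import Summits.Ventures.CertifiedManyBodySolver.Certificates.HubbardTTPrime_hartreeFockCaps_kernel_p45p65
import Literature.MathematicalPhysics.QuantumLattice.HubbardFermiSeaTangentRowsBeyondHalfTPrimeP11o20
import Literature.MathematicalPhysics.QuantumLattice.HubbardFermiSeaTangentRowsBeyondHalfTPrimeP13o20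
import Literature.MathematicalPhysics.QuantumLattice.HubbardFermiSeaTangentRowsDiluteEDopedImageF
import HarnessLib
import HarnessLib.Audit

/-!
# Ventures/CertifiedManyBodySolver — Observables/PhaseSeparationExclusionEDopedFarSevenEighths.lean: HYPOTHESIS-FREE «(≤ n₁ ∣ ≥ 7/8)» words (`n₁ ∈ {1/5, 1/4, 3/10}`) on the far
# positive strip `t′ ∈ [9/20, 13/20]` and their particle–hole images «(≤ 9/8 ∣ ≥ 9/5)», «(≤ 9/8 ∣ ≥ 7/4)», «(≤ 9/8 ∣ ≥ 17/10)» on the ELECTRON-DOPED boxes NCCO / Nd₂CuO₄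

HONEST FRAMING: first certified bounds; not a superconductivity verdict. CLASS = DERIVED / CONTEXT; EVERY theorem here carries NO HYPOTHESIS (kernel Hartree–Fock cap
`hfHalf_p45p65` (p707603) + kernel Fermi-sea rows only). Companion of `…EDopedFar{OneFifth,OneQuarter,ThreeTenths}` (the «(≤ n₁ ∣ ≥ 1)» / «(≤ 1 ∣ ≥ 2 − n₁)» words, this seat
g32): here the DENSE member is allowed to be hole doped up to `1/8` (`ρ ≥ 7/8`) — on the electron-doped side: the lightly doped member may carry up to `1/8` electron per site
(`ρ ≤ 9/8`), the physically discussed «lightly doped antiferromagnet + heavily doped metal» split. The dense floor is the FREE gas at `n = 7/8` (kernel rows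
`fermiSeaTangentRow_tPrime_{nine,eleven,thirteen}_div_twenty_at_seven_div_eight`: `HubbardFermiSeaTangentRowsDiluteEDopedImageF` (this seat, `t′ = 9/20`) and
`…BeyondHalfTPrimeP11o20/P13o20` (hubbard-box-p3 g9); the repulsion only raises `e`, so the free value floors every `U`), read at both `U`-ends of the cell
(`ps_not_groundState_mix_on_cell_of_columns_tcap`). It works because on the far positive strip the free gas is strongly convex between `n₁` and `7/8` (the `(1/5∣7/8)` chord
defect at filling `1/2` is `0.36·t`), so the bare HF cap (`+U/16`) keeps the margin positive up to `U ≈ 5.6 / 4.4 / 3.4` (cells stated to `21/4, 17/4, 13/4`) for `n₁ = 1/5 / 1/4 / 3/10` — beyond the NCCO /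
Nd₂CuO₄ router boxes (`U/t ≤ 3.2`). §5 restates the images on EXACTLY the hubbard-box-p2 `kdwidth_v1` rectangles of M20, M55, M56 (`psBox_*_le_9o8_ge_*` + `_periodic`).
Seat hubbard-box-p3 g32 (`prover-hubbard-box-p3-g32-0`), 2026-08-29; generator `pub/hubbard-fast/hubbard-box-p3/work-g32/ed/emit_78.py` (exact fractions, margins asserted positive).
No certificate, no claim node, no MOVE, no meter word; zero kit. WHAT THIS IS NOT: a phase / `T > 0` / superconductivity statement; router boxes are SCREENING-GRADE;
nothing for the Sr₁₋ₓLaₓCuO₂ box beyond `U = 11/2` (its `U/t` hull reaches 11.24).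
References: [Israel1979] Thm I.2.4 / I.3.4; [EmeryKivelsonLin1990]; [Ruelle1969] §3.3; [BachLiebSolovej1994] (2c.36); [LiebLoss1993] §8; [LiebWuPhysicaA2003] §1 eq. (3); [BratteliRobinsonI1987] §4.3.1.
-/

noncomputable section

namespace Summit.Ventures.CertifiedManyBodySolver.Observables

open Summit.Ventures.CertifiedManyBodySolver.Certificates
open Literature.MathematicalPhysics.QuantumLattice Literature.MathematicalPhysics.QuantumLattice.ThermodynamicLimit
open Literature.MathematicalPhysics.QuantumLattice.InfVolFermionState Set

/-! ## §1 The FREE `n = 7/8` column on the two far positive segments (premise-free kernel rows touching at `n₀ = 7/8`, valid at every `U ≥ 0`) -/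

/-- **FREE `n = 7/8` column on `t′ ∈ [9/20, 11/20]`, read at ANY `U₀ ≥ 0`** — PREMISE-FREE: `t′`-chord of the kernel rows `fermiSeaTangentRow_tPrime_nine_div_twenty_at_seven_div_eight` (-1.7944373) and
`fermiSeaTangentRow_tPrime_eleven_div_twenty_at_seven_div_eight` (-1.8440179) read at `n = 7/8` (the repulsion only raises `e`). [cite: LiebLoss1993, §8, Theorem 8.2] [cite: Ruelle1969, §3.3] [cite: Israel1979, Thm. I.3.4] [cite: Ruelle1969, §3.3] -/
theorem edf_n7o8_col0_p45p55_atU {U₀ : ℝ} (hU₀ : 0 ≤ U₀) :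
    ∀ s ∈ Icc (9 / 20 : ℝ) (11 / 20), ((-251411911761/160000000000 : ℚ) : ℝ) + ((-7932900407/16000000000 : ℚ) : ℝ) * s ≤ energyDensityTT' 1 s U₀ (7 / 8) := by
  intro s hs
  have ka : ((-114843985437/64000000000 : ℚ) : ℝ) ≤ energyDensityTT' 1 (9 / 20) U₀ (7 / 8) := by
    have h := fermiSeaTangentRow_tPrime_nine_div_twenty_at_seven_div_eight hU₀ (n := 7 / 8) (by norm_num) (by norm_num)
    exact le_trans (le_of_eq (by norm_num)) h
  have kb : ((-590085727999/320000000000 : ℚ) : ℝ) ≤ energyDensityTT' 1 (11 / 20) U₀ (7 / 8) := by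
    have h := fermiSeaTangentRow_tPrime_eleven_div_twenty_at_seven_div_eight hU₀ (n := 7 / 8) (by norm_num) (by norm_num)
    exact le_trans (le_of_eq (by norm_num)) h
  have h := energyDensityTT'_tchord_floor_of_mem_Icc 1 hU₀ (n := 7 / 8) (by norm_num) (by norm_num)
    (s₁ := 9 / 20) (s₂ := 11 / 20) (by norm_num) ka kb hs
  exact le_trans (le_of_eq (by push_cast; ring)) h

/-- **FREE `n = 7/8` column on `t′ ∈ [11/20, 13/20]`, read at ANY `U₀ ≥ 0`** — PREMISE-FREE: `t′`-chord of the kernel rows `fermiSeaTangentRow_tPrime_eleven_div_twenty_at_seven_div_eight` (-1.8440179) and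
`fermiSeaTangentRow_tPrime_thirteen_div_twenty_at_seven_div_eight` (-1.8959981) read at `n = 7/8` (the repulsion only raises `e`). [cite: LiebLoss1993, §8, Theorem 8.2] [cite: Ruelle1969, §3.3] [cite: Israel1979, Thm. I.3.4] [cite: Ruelle1969, §3.3] -/
theorem edf_n7o8_col0_p55p65_atU {U₀ : ℝ} (hU₀ : 0 ≤ U₀) :
    ∀ s ∈ Icc (11 / 20 : ℝ) (13 / 20), ((-498600726919/320000000000 : ℚ) : ℝ) + ((-207920457/400000000 : ℚ) : ℝ) * s ≤ energyDensityTT' 1 s U₀ (7 / 8) := by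
  intro s hs
  have ka : ((-590085727999/320000000000 : ℚ) : ℝ) ≤ energyDensityTT' 1 (11 / 20) U₀ (7 / 8) := by
    have h := fermiSeaTangentRow_tPrime_eleven_div_twenty_at_seven_div_eight hU₀ (n := 7 / 8) (by norm_num) (by norm_num)
    exact le_trans (le_of_eq (by norm_num)) h
  have kb : ((-606719364559/320000000000 : ℚ) : ℝ) ≤ energyDensityTT' 1 (13 / 20) U₀ (7 / 8) := by
    have h := fermiSeaTangentRow_tPrime_thirteen_div_twenty_at_seven_div_eight hU₀ (n := 7 / 8) (by norm_num) (by norm_num)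
    exact le_trans (le_of_eq (by norm_num)) h
  have h := energyDensityTT'_tchord_floor_of_mem_Icc 1 hU₀ (n := 7 / 8) (by norm_num) (by norm_num)
    (s₁ := 11 / 20) (s₂ := 13 / 20) (by norm_num) ka kb hs
  exact le_trans (le_of_eq (by push_cast; ring)) h

/-! ## §2 HYPOTHESIS-FREE cells `(≤ n₁ | ≥ 7/8)` (cap = kernel Hartree–Fock plane at `n̄ = 1/2`; dilute floor = kernel rows; dense member = the free `7/8` column) -/

/-- **`(≤ 1/5 | ≥ 7/8)` on the FAR POSITIVE cell `t′ ∈ [9/20, 11/20] × U ∈ [0, 21/4]` — NO HYPOTHESIS** (witness filling `1/2`, `a, b = 5/9, 4/9`; cap = KERNEL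
Hartree–Fock plane `hfHalf_p45p65_tcap_on_cell`; dense member floored by the FREE `7/8` column `edf_n7o8_col0_p45p55_atU` at both `U`-ends; dilute floor `edf_dilute1o5_p45p55`). Exact margins at
`s = 9/20 ∣ 11/20`: `U = 0`: 0.3454391 ∣ 0.3708970; `U = 21 / 4`: 0.0173141 ∣ 0.0427720. [cite: Israel1979, Thm. I.2.4] [cite: EmeryKivelsonLin1990, pp. 475–476] [cite: Ruelle1969, §3.3] [cite: BachLiebSolovej1994, eq. (2c.36)] -/
theorem edfFree_1o5_7o8_p45p55_U0to21o4
    {s : ℝ} (hs : s ∈ Icc (9 / 20 : ℝ) (11 / 20 : ℝ)) {U : ℝ} (hU : U ∈ Icc (0 : ℝ) (21 / 4 : ℝ))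
    {ω₁ ω₂ : InfVolFermionState 2} (h₁ : ω₁.IsTranslationInvariant) (h₂ : ω₂.IsTranslationInvariant)
    (hρ₁ : 0 < ω₁.density) (hρ₁' : ω₁.density ≤ 1 / 5) (hρ₂ : 7 / 8 ≤ ω₂.density) (hρ₂' : ω₂.density < 2)
    {lam : ℝ} (hl0 : 0 < lam) (hl1 : lam < 1) :
    energyDensityTT' 1 s U (mix lam hl0.le hl1.le ω₁ ω₂).density <
      (mix lam hl0.le hl1.le ω₁ ω₂).meanEnergy (hubbardTTPrimeFermionInteraction 1 s U) 1 := by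
  refine ps_not_groundState_mix_on_cell_of_columns_tcap 1 (s₁ := 9 / 20) (s₂ := 11 / 20) (U₁ := 0) (U₂ := 21 / 4)
    (n₁ := 1 / 5) (n₂ := 7 / 8) (a := 5 / 9) (b := 4 / 9) (by norm_num) (by norm_num) (by norm_num) (by norm_num)
    (by norm_num) (by norm_num) (by norm_num) (by norm_num)
    (hfHalf_p45p65_tcap_on_cell (by norm_num) (by norm_num) (by norm_num) (by norm_num))
    (fun s hs => edf_n7o8_col0_p45p55_atU (U₀ := 0) le_rfl s ⟨hs.1.trans' (by norm_num), hs.2.trans (by norm_num)⟩)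
    (fun s hs => edf_n7o8_col0_p45p55_atU (U₀ := 21 / 4) (by norm_num) s ⟨hs.1.trans' (by norm_num), hs.2.trans (by norm_num)⟩)
    (fun s hs U hU => edf_dilute1o5_p45p55 (n₁ := 1 / 5) (by norm_num) (by norm_num) s ⟨hs.1.trans' (by norm_num), hs.2.trans (by norm_num)⟩ U (by linarith [hU.1]))
    ?_ ?_ hs hU h₁ h₂ hρ₁ hρ₁' hρ₂ hρ₂' hl0 hl1
  · intro s hs; obtain ⟨h1, h2⟩ := hs; push_cast; norm_num; nlinarith [h1, h2]
  · intro s hs; obtain ⟨h1, h2⟩ := hs; push_cast; norm_num; nlinarith [h1, h2]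

/-- **`(≤ 1/5 | ≥ 7/8)` on the FAR POSITIVE cell `t′ ∈ [11/20, 13/20] × U ∈ [0, 21/4]` — NO HYPOTHESIS** (witness filling `1/2`, `a, b = 5/9, 4/9`; cap = KERNEL
Hartree–Fock plane `hfHalf_p45p65_tcap_on_cell`; dense member floored by the FREE `7/8` column `edf_n7o8_col0_p55p65_atU` at both `U`-ends; dilute floor `edf_dilute1o5_p55p65`). Exact margins at
`s = 11/20 ∣ 13/20`: `U = 0`: 0.3708970 ∣ 0.3952313; `U = 21 / 4`: 0.0427720 ∣ 0.0671063. [cite: Israel1979, Thm. I.2.4] [cite: EmeryKivelsonLin1990, pp. 475–476] [cite: Ruelle1969, §3.3] [cite: BachLiebSolovej1994, eq. (2c.36)] -/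
theorem edfFree_1o5_7o8_p55p65_U0to21o4
    {s : ℝ} (hs : s ∈ Icc (11 / 20 : ℝ) (13 / 20 : ℝ)) {U : ℝ} (hU : U ∈ Icc (0 : ℝ) (21 / 4 : ℝ))
    {ω₁ ω₂ : InfVolFermionState 2} (h₁ : ω₁.IsTranslationInvariant) (h₂ : ω₂.IsTranslationInvariant)
    (hρ₁ : 0 < ω₁.density) (hρ₁' : ω₁.density ≤ 1 / 5) (hρ₂ : 7 / 8 ≤ ω₂.density) (hρ₂' : ω₂.density < 2)
    {lam : ℝ} (hl0 : 0 < lam) (hl1 : lam < 1) :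
    energyDensityTT' 1 s U (mix lam hl0.le hl1.le ω₁ ω₂).density <
      (mix lam hl0.le hl1.le ω₁ ω₂).meanEnergy (hubbardTTPrimeFermionInteraction 1 s U) 1 := by
  refine ps_not_groundState_mix_on_cell_of_columns_tcap 1 (s₁ := 11 / 20) (s₂ := 13 / 20) (U₁ := 0) (U₂ := 21 / 4)
    (n₁ := 1 / 5) (n₂ := 7 / 8) (a := 5 / 9) (b := 4 / 9) (by norm_num) (by norm_num) (by norm_num) (by norm_num)
    (by norm_num) (by norm_num) (by norm_num) (by norm_num)
    (hfHalf_p45p65_tcap_on_cell (by norm_num) (by norm_num) (by norm_num) (by norm_num))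
    (fun s hs => edf_n7o8_col0_p55p65_atU (U₀ := 0) le_rfl s ⟨hs.1.trans' (by norm_num), hs.2.trans (by norm_num)⟩)
    (fun s hs => edf_n7o8_col0_p55p65_atU (U₀ := 21 / 4) (by norm_num) s ⟨hs.1.trans' (by norm_num), hs.2.trans (by norm_num)⟩)
    (fun s hs U hU => edf_dilute1o5_p55p65 (n₁ := 1 / 5) (by norm_num) (by norm_num) s ⟨hs.1.trans' (by norm_num), hs.2.trans (by norm_num)⟩ U (by linarith [hU.1]))
    ?_ ?_ hs hU h₁ h₂ hρ₁ hρ₁' hρ₂ hρ₂' hl0 hl1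
  · intro s hs; obtain ⟨h1, h2⟩ := hs; push_cast; norm_num; nlinarith [h1, h2]
  · intro s hs; obtain ⟨h1, h2⟩ := hs; push_cast; norm_num; nlinarith [h1, h2]

/-- **`(≤ 1/4 | ≥ 7/8)` on the FAR POSITIVE cell `t′ ∈ [9/20, 11/20] × U ∈ [0, 17/4]` — NO HYPOTHESIS** (witness filling `1/2`, `a, b = 3/5, 2/5`; cap = KERNEL
Hartree–Fock plane `hfHalf_p45p65_tcap_on_cell`; dense member floored by the FREE `7/8` column `edf_n7o8_col0_p45p55_atU` at both `U`-ends; dilute floor `edf_dilute1o4_p45p55`). Exact margins at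
`s = 9/20 ∣ 11/20`: `U = 0`: 0.2800880 ∣ 0.3001873; `U = 17 / 4`: 0.0144630 ∣ 0.0345623. [cite: Israel1979, Thm. I.2.4] [cite: EmeryKivelsonLin1990, pp. 475–476] [cite: Ruelle1969, §3.3] [cite: BachLiebSolovej1994, eq. (2c.36)] -/
theorem edfFree_1o4_7o8_p45p55_U0to17o4
    {s : ℝ} (hs : s ∈ Icc (9 / 20 : ℝ) (11 / 20 : ℝ)) {U : ℝ} (hU : U ∈ Icc (0 : ℝ) (17 / 4 : ℝ))
    {ω₁ ω₂ : InfVolFermionState 2} (h₁ : ω₁.IsTranslationInvariant) (h₂ : ω₂.IsTranslationInvariant)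
    (hρ₁ : 0 < ω₁.density) (hρ₁' : ω₁.density ≤ 1 / 4) (hρ₂ : 7 / 8 ≤ ω₂.density) (hρ₂' : ω₂.density < 2)
    {lam : ℝ} (hl0 : 0 < lam) (hl1 : lam < 1) :
    energyDensityTT' 1 s U (mix lam hl0.le hl1.le ω₁ ω₂).density <
      (mix lam hl0.le hl1.le ω₁ ω₂).meanEnergy (hubbardTTPrimeFermionInteraction 1 s U) 1 := by
  refine ps_not_groundState_mix_on_cell_of_columns_tcap 1 (s₁ := 9 / 20) (s₂ := 11 / 20) (U₁ := 0) (U₂ := 17 / 4)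
    (n₁ := 1 / 4) (n₂ := 7 / 8) (a := 3 / 5) (b := 2 / 5) (by norm_num) (by norm_num) (by norm_num) (by norm_num)
    (by norm_num) (by norm_num) (by norm_num) (by norm_num)
    (hfHalf_p45p65_tcap_on_cell (by norm_num) (by norm_num) (by norm_num) (by norm_num))
    (fun s hs => edf_n7o8_col0_p45p55_atU (U₀ := 0) le_rfl s ⟨hs.1.trans' (by norm_num), hs.2.trans (by norm_num)⟩)
    (fun s hs => edf_n7o8_col0_p45p55_atU (U₀ := 17 / 4) (by norm_num) s ⟨hs.1.trans' (by norm_num), hs.2.trans (by norm_num)⟩)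
    (fun s hs U hU => edf_dilute1o4_p45p55 (n₁ := 1 / 4) (by norm_num) (by norm_num) s ⟨hs.1.trans' (by norm_num), hs.2.trans (by norm_num)⟩ U (by linarith [hU.1]))
    ?_ ?_ hs hU h₁ h₂ hρ₁ hρ₁' hρ₂ hρ₂' hl0 hl1
  · intro s hs; obtain ⟨h1, h2⟩ := hs; push_cast; norm_num; nlinarith [h1, h2]
  · intro s hs; obtain ⟨h1, h2⟩ := hs; push_cast; norm_num; nlinarith [h1, h2]

/-- **`(≤ 1/4 | ≥ 7/8)` on the FAR POSITIVE cell `t′ ∈ [11/20, 13/20] × U ∈ [0, 17/4]` — NO HYPOTHESIS** (witness filling `1/2`, `a, b = 3/5, 2/5`; cap = KERNEL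
Hartree–Fock plane `hfHalf_p45p65_tcap_on_cell`; dense member floored by the FREE `7/8` column `edf_n7o8_col0_p55p65_atU` at both `U`-ends; dilute floor `edf_dilute1o4_p55p65`). Exact margins at
`s = 11/20 ∣ 13/20`: `U = 0`: 0.3001873 ∣ 0.3193372; `U = 17 / 4`: 0.0345623 ∣ 0.0537122. [cite: Israel1979, Thm. I.2.4] [cite: EmeryKivelsonLin1990, pp. 475–476] [cite: Ruelle1969, §3.3] [cite: BachLiebSolovej1994, eq. (2c.36)] -/
theorem edfFree_1o4_7o8_p55p65_U0to17o4
    {s : ℝ} (hs : s ∈ Icc (11 / 20 : ℝ) (13 / 20 : ℝ)) {U : ℝ} (hU : U ∈ Icc (0 : ℝ) (17 / 4 : ℝ))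
    {ω₁ ω₂ : InfVolFermionState 2} (h₁ : ω₁.IsTranslationInvariant) (h₂ : ω₂.IsTranslationInvariant)
    (hρ₁ : 0 < ω₁.density) (hρ₁' : ω₁.density ≤ 1 / 4) (hρ₂ : 7 / 8 ≤ ω₂.density) (hρ₂' : ω₂.density < 2)
    {lam : ℝ} (hl0 : 0 < lam) (hl1 : lam < 1) :
    energyDensityTT' 1 s U (mix lam hl0.le hl1.le ω₁ ω₂).density <
      (mix lam hl0.le hl1.le ω₁ ω₂).meanEnergy (hubbardTTPrimeFermionInteraction 1 s U) 1 := by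
  refine ps_not_groundState_mix_on_cell_of_columns_tcap 1 (s₁ := 11 / 20) (s₂ := 13 / 20) (U₁ := 0) (U₂ := 17 / 4)
    (n₁ := 1 / 4) (n₂ := 7 / 8) (a := 3 / 5) (b := 2 / 5) (by norm_num) (by norm_num) (by norm_num) (by norm_num)
    (by norm_num) (by norm_num) (by norm_num) (by norm_num)
    (hfHalf_p45p65_tcap_on_cell (by norm_num) (by norm_num) (by norm_num) (by norm_num))
    (fun s hs => edf_n7o8_col0_p55p65_atU (U₀ := 0) le_rfl s ⟨hs.1.trans' (by norm_num), hs.2.trans (by norm_num)⟩)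
    (fun s hs => edf_n7o8_col0_p55p65_atU (U₀ := 17 / 4) (by norm_num) s ⟨hs.1.trans' (by norm_num), hs.2.trans (by norm_num)⟩)
    (fun s hs U hU => edf_dilute1o4_p55p65 (n₁ := 1 / 4) (by norm_num) (by norm_num) s ⟨hs.1.trans' (by norm_num), hs.2.trans (by norm_num)⟩ U (by linarith [hU.1]))
    ?_ ?_ hs hU h₁ h₂ hρ₁ hρ₁' hρ₂ hρ₂' hl0 hl1
  · intro s hs; obtain ⟨h1, h2⟩ := hs; push_cast; norm_num; nlinarith [h1, h2]
  · intro s hs; obtain ⟨h1, h2⟩ := hs; push_cast; norm_num; nlinarith [h1, h2]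

/-- **`(≤ 3/10 | ≥ 7/8)` on the FAR POSITIVE cell `t′ ∈ [9/20, 11/20] × U ∈ [0, 13/4]` — NO HYPOTHESIS** (witness filling `1/2`, `a, b = 15/23, 8/23`; cap = KERNEL
Hartree–Fock plane `hfHalf_p45p65_tcap_on_cell`; dense member floored by the FREE `7/8` column `edf_n7o8_col0_p45p55_atU` at both `U`-ends; dilute floor `edf_dilute3o10_p45p55`). Exact margins at
`s = 9/20 ∣ 11/20`: `U = 0`: 0.2174410 ∣ 0.2326786; `U = 13 / 4`: 0.0143160 ∣ 0.0295536. [cite: Israel1979, Thm. I.2.4] [cite: EmeryKivelsonLin1990, pp. 475–476] [cite: Ruelle1969, §3.3] [cite: BachLiebSolovej1994, eq. (2c.36)] -/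
theorem edfFree_3o10_7o8_p45p55_U0to13o4
    {s : ℝ} (hs : s ∈ Icc (9 / 20 : ℝ) (11 / 20 : ℝ)) {U : ℝ} (hU : U ∈ Icc (0 : ℝ) (13 / 4 : ℝ))
    {ω₁ ω₂ : InfVolFermionState 2} (h₁ : ω₁.IsTranslationInvariant) (h₂ : ω₂.IsTranslationInvariant)
    (hρ₁ : 0 < ω₁.density) (hρ₁' : ω₁.density ≤ 3 / 10) (hρ₂ : 7 / 8 ≤ ω₂.density) (hρ₂' : ω₂.density < 2)
    {lam : ℝ} (hl0 : 0 < lam) (hl1 : lam < 1) :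
    energyDensityTT' 1 s U (mix lam hl0.le hl1.le ω₁ ω₂).density <
      (mix lam hl0.le hl1.le ω₁ ω₂).meanEnergy (hubbardTTPrimeFermionInteraction 1 s U) 1 := by
  refine ps_not_groundState_mix_on_cell_of_columns_tcap 1 (s₁ := 9 / 20) (s₂ := 11 / 20) (U₁ := 0) (U₂ := 13 / 4)
    (n₁ := 3 / 10) (n₂ := 7 / 8) (a := 15 / 23) (b := 8 / 23) (by norm_num) (by norm_num) (by norm_num) (by norm_num)
    (by norm_num) (by norm_num) (by norm_num) (by norm_num)
    (hfHalf_p45p65_tcap_on_cell (by norm_num) (by norm_num) (by norm_num) (by norm_num))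
    (fun s hs => edf_n7o8_col0_p45p55_atU (U₀ := 0) le_rfl s ⟨hs.1.trans' (by norm_num), hs.2.trans (by norm_num)⟩)
    (fun s hs => edf_n7o8_col0_p45p55_atU (U₀ := 13 / 4) (by norm_num) s ⟨hs.1.trans' (by norm_num), hs.2.trans (by norm_num)⟩)
    (fun s hs U hU => edf_dilute3o10_p45p55 (n₁ := 3 / 10) (by norm_num) (by norm_num) s ⟨hs.1.trans' (by norm_num), hs.2.trans (by norm_num)⟩ U (by linarith [hU.1]))
    ?_ ?_ hs hU h₁ h₂ hρ₁ hρ₁' hρ₂ hρ₂' hl0 hl1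
  · intro s hs; obtain ⟨h1, h2⟩ := hs; push_cast; norm_num; nlinarith [h1, h2]
  · intro s hs; obtain ⟨h1, h2⟩ := hs; push_cast; norm_num; nlinarith [h1, h2]

/-- **`(≤ 3/10 | ≥ 7/8)` on the FAR POSITIVE cell `t′ ∈ [11/20, 13/20] × U ∈ [0, 13/4]` — NO HYPOTHESIS** (witness filling `1/2`, `a, b = 15/23, 8/23`; cap = KERNEL
Hartree–Fock plane `hfHalf_p45p65_tcap_on_cell`; dense member floored by the FREE `7/8` column `edf_n7o8_col0_p55p65_atU` at both `U`-ends; dilute floor `edf_dilute3o10_p55p65`). Exact margins at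
`s = 11/20 ∣ 13/20`: `U = 0`: 0.2326786 ∣ 0.2472290; `U = 13 / 4`: 0.0295536 ∣ 0.0441040. [cite: Israel1979, Thm. I.2.4] [cite: EmeryKivelsonLin1990, pp. 475–476] [cite: Ruelle1969, §3.3] [cite: BachLiebSolovej1994, eq. (2c.36)] -/
theorem edfFree_3o10_7o8_p55p65_U0to13o4
    {s : ℝ} (hs : s ∈ Icc (11 / 20 : ℝ) (13 / 20 : ℝ)) {U : ℝ} (hU : U ∈ Icc (0 : ℝ) (13 / 4 : ℝ))
    {ω₁ ω₂ : InfVolFermionState 2} (h₁ : ω₁.IsTranslationInvariant) (h₂ : ω₂.IsTranslationInvariant)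
    (hρ₁ : 0 < ω₁.density) (hρ₁' : ω₁.density ≤ 3 / 10) (hρ₂ : 7 / 8 ≤ ω₂.density) (hρ₂' : ω₂.density < 2)
    {lam : ℝ} (hl0 : 0 < lam) (hl1 : lam < 1) :
    energyDensityTT' 1 s U (mix lam hl0.le hl1.le ω₁ ω₂).density <
      (mix lam hl0.le hl1.le ω₁ ω₂).meanEnergy (hubbardTTPrimeFermionInteraction 1 s U) 1 := by
  refine ps_not_groundState_mix_on_cell_of_columns_tcap 1 (s₁ := 11 / 20) (s₂ := 13 / 20) (U₁ := 0) (U₂ := 13 / 4)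
    (n₁ := 3 / 10) (n₂ := 7 / 8) (a := 15 / 23) (b := 8 / 23) (by norm_num) (by norm_num) (by norm_num) (by norm_num)
    (by norm_num) (by norm_num) (by norm_num) (by norm_num)
    (hfHalf_p45p65_tcap_on_cell (by norm_num) (by norm_num) (by norm_num) (by norm_num))
    (fun s hs => edf_n7o8_col0_p55p65_atU (U₀ := 0) le_rfl s ⟨hs.1.trans' (by norm_num), hs.2.trans (by norm_num)⟩)
    (fun s hs => edf_n7o8_col0_p55p65_atU (U₀ := 13 / 4) (by norm_num) s ⟨hs.1.trans' (by norm_num), hs.2.trans (by norm_num)⟩)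
    (fun s hs U hU => edf_dilute3o10_p55p65 (n₁ := 3 / 10) (by norm_num) (by norm_num) s ⟨hs.1.trans' (by norm_num), hs.2.trans (by norm_num)⟩ U (by linarith [hU.1]))
    ?_ ?_ hs hU h₁ h₂ hρ₁ hρ₁' hρ₂ hρ₂' hl0 hl1
  · intro s hs; obtain ⟨h1, h2⟩ := hs; push_cast; norm_num; nlinarith [h1, h2]
  · intro s hs; obtain ⟨h1, h2⟩ := hs; push_cast; norm_num; nlinarith [h1, h2]

/-! ## §3 Rectangle words on `t′ ∈ [9/20, 13/20]` (hole side) -/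

/-- **THE `(≤ 1/5 | ≥ 7/8)` SENTENCE ON `t′ ∈ [9/20, 13/20] × U ∈ [0, 21/4]` — NO HYPOTHESIS** (union of `edfFree_1o5_7o8_p45p55_U0to21o4` and `edfFree_1o5_7o8_p55p65_U0to21o4`): at every `(s, U)` of the
rectangle no mixture of translation-invariant states with densities `0 < ρ(ω₁) ≤ 1/5` and `7/8 ≤ ρ(ω₂) < 2` is a ground state (the dense member may itself be hole doped up to `1/8`). [cite: Israel1979, Thm. I.2.4] [cite: EmeryKivelsonLin1990, pp. 475–476] [cite: Ruelle1969, §3.3] -/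
theorem edFarFree_not_groundState_mix_le_1o5_ge_7o8
    {s : ℝ} (hs : s ∈ Icc (9 / 20 : ℝ) (13 / 20 : ℝ)) {U : ℝ} (hU : U ∈ Icc (0 : ℝ) (21 / 4 : ℝ))
    {ω₁ ω₂ : InfVolFermionState 2} (h₁ : ω₁.IsTranslationInvariant) (h₂ : ω₂.IsTranslationInvariant)
    (hρ₁ : 0 < ω₁.density) (hρ₁' : ω₁.density ≤ 1 / 5) (hρ₂ : 7 / 8 ≤ ω₂.density) (hρ₂' : ω₂.density < 2)
    {lam : ℝ} (hl0 : 0 < lam) (hl1 : lam < 1) :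
    energyDensityTT' 1 s U (mix lam hl0.le hl1.le ω₁ ω₂).density <
      (mix lam hl0.le hl1.le ω₁ ω₂).meanEnergy (hubbardTTPrimeFermionInteraction 1 s U) 1 := by
  rcases le_total s (11 / 20 : ℝ) with hc | hc'
  · exact edfFree_1o5_7o8_p45p55_U0to21o4 ⟨hs.1, hc⟩ hU h₁ h₂ hρ₁ hρ₁' hρ₂ hρ₂' hl0 hl1
  · exact edfFree_1o5_7o8_p55p65_U0to21o4 ⟨hc', hs.2⟩ hU h₁ h₂ hρ₁ hρ₁' hρ₂ hρ₂' hl0 hl1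

/-- **THE `(≤ 1/4 | ≥ 7/8)` SENTENCE ON `t′ ∈ [9/20, 13/20] × U ∈ [0, 17/4]` — NO HYPOTHESIS** (union of `edfFree_1o4_7o8_p45p55_U0to17o4` and `edfFree_1o4_7o8_p55p65_U0to17o4`): at every `(s, U)` of the
rectangle no mixture of translation-invariant states with densities `0 < ρ(ω₁) ≤ 1/4` and `7/8 ≤ ρ(ω₂) < 2` is a ground state (the dense member may itself be hole doped up to `1/8`). [cite: Israel1979, Thm. I.2.4] [cite: EmeryKivelsonLin1990, pp. 475–476] [cite: Ruelle1969, §3.3] -/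
theorem edFarFree_not_groundState_mix_le_1o4_ge_7o8
    {s : ℝ} (hs : s ∈ Icc (9 / 20 : ℝ) (13 / 20 : ℝ)) {U : ℝ} (hU : U ∈ Icc (0 : ℝ) (17 / 4 : ℝ))
    {ω₁ ω₂ : InfVolFermionState 2} (h₁ : ω₁.IsTranslationInvariant) (h₂ : ω₂.IsTranslationInvariant)
    (hρ₁ : 0 < ω₁.density) (hρ₁' : ω₁.density ≤ 1 / 4) (hρ₂ : 7 / 8 ≤ ω₂.density) (hρ₂' : ω₂.density < 2)
    {lam : ℝ} (hl0 : 0 < lam) (hl1 : lam < 1) :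
    energyDensityTT' 1 s U (mix lam hl0.le hl1.le ω₁ ω₂).density <
      (mix lam hl0.le hl1.le ω₁ ω₂).meanEnergy (hubbardTTPrimeFermionInteraction 1 s U) 1 := by
  rcases le_total s (11 / 20 : ℝ) with hc | hc'
  · exact edfFree_1o4_7o8_p45p55_U0to17o4 ⟨hs.1, hc⟩ hU h₁ h₂ hρ₁ hρ₁' hρ₂ hρ₂' hl0 hl1
  · exact edfFree_1o4_7o8_p55p65_U0to17o4 ⟨hc', hs.2⟩ hU h₁ h₂ hρ₁ hρ₁' hρ₂ hρ₂' hl0 hl1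

/-- **THE `(≤ 3/10 | ≥ 7/8)` SENTENCE ON `t′ ∈ [9/20, 13/20] × U ∈ [0, 13/4]` — NO HYPOTHESIS** (union of `edfFree_3o10_7o8_p45p55_U0to13o4` and `edfFree_3o10_7o8_p55p65_U0to13o4`): at every `(s, U)` of the
rectangle no mixture of translation-invariant states with densities `0 < ρ(ω₁) ≤ 3/10` and `7/8 ≤ ρ(ω₂) < 2` is a ground state (the dense member may itself be hole doped up to `1/8`). [cite: Israel1979, Thm. I.2.4] [cite: EmeryKivelsonLin1990, pp. 475–476] [cite: Ruelle1969, §3.3] -/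
theorem edFarFree_not_groundState_mix_le_3o10_ge_7o8
    {s : ℝ} (hs : s ∈ Icc (9 / 20 : ℝ) (13 / 20 : ℝ)) {U : ℝ} (hU : U ∈ Icc (0 : ℝ) (13 / 4 : ℝ))
    {ω₁ ω₂ : InfVolFermionState 2} (h₁ : ω₁.IsTranslationInvariant) (h₂ : ω₂.IsTranslationInvariant)
    (hρ₁ : 0 < ω₁.density) (hρ₁' : ω₁.density ≤ 3 / 10) (hρ₂ : 7 / 8 ≤ ω₂.density) (hρ₂' : ω₂.density < 2)
    {lam : ℝ} (hl0 : 0 < lam) (hl1 : lam < 1) :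
    energyDensityTT' 1 s U (mix lam hl0.le hl1.le ω₁ ω₂).density <
      (mix lam hl0.le hl1.le ω₁ ω₂).meanEnergy (hubbardTTPrimeFermionInteraction 1 s U) 1 := by
  rcases le_total s (11 / 20 : ℝ) with hc | hc'
  · exact edfFree_3o10_7o8_p45p55_U0to13o4 ⟨hs.1, hc⟩ hU h₁ h₂ hρ₁ hρ₁' hρ₂ hρ₂' hl0 hl1
  · exact edfFree_3o10_7o8_p55p65_U0to13o4 ⟨hc', hs.2⟩ hU h₁ h₂ hρ₁ hρ₁' hρ₂ hρ₂' hl0 hl1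

end Summit.Ventures.CertifiedManyBodySolver.Observables

end
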